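import Literature.MathematicalPhysics.QuantumFieldTheory.Balaban1983to89.B13Sqrt27AccretiveAlmostLocal
import HarnessLib

/-!
# Route `UnitScaleTilt`, crux K1 «MinimiserStabilityRegPr» (stmt-QuantumFields-19200), EX rows `h349` ∕ `hGF` (curved member) — **BRICK (L0) OF LOCATE-P349-CT (★p1 g24):
# THE KERNEL OF THE ORTHOGONAL PROJECTION ONTO `Δ(N)` DECAYS EXPONENTIALLY WHENEVER `N` IS BLOCK-LOCAL AND `Δ` IS A FINITE-RANGE HERMITIAN OPERATOR COERCIVE ON `N`**
# — the Combes–Thomas ∕ LOD-localisation core behind [Balaban1985BackgroundPropagators] (3.49) for print's gauge projector `R(U) = proj_{Δ^η_U N(Q′)}` (p.394),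
# abstract and carrier-free (any finite index set with a pseudo-metric), over lit's diagonal-blind Combes–Thomas engine ✓`B13Sqrt27AccretiveAlmostLocal.almostLocal_inverse_decay`

Cell `ym3-torus` (HUMAN RULING D-0037, YM ladder rung R3 — NOT d = 4, NOT a mass gap, NOT Clay).  Fleet lead seat `ym-ust-19200-p1` gen 24; memo `LOCATE-P349-CT-p1g24.md`
(19200 evidence).  THEOREMS ONLY (0 `def`, 0 `sorry`), Mathlib + lit; `--supports stmt-QuantumFields-19200 --as helper`, count-neutral.  Nothing of (3.49), Thm 3.3∕3.10∕3.11,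
`h349`, `hGF`, EX or the crux is claimed: this is the ABSTRACT core; the member reading (block covariant Poincaré on `ker Q″`, the explicit matrices of `Δ^η_{U₀}` and of the
top nested mean `Q″`, the pointwise `η³`) is bricks (L1)–(L3) of the memo.

THE MATHEMATICS.  `n` a finite index set, `d` a pseudo-metric on it («block distance»: `d = 0` inside a coarse block).  `Pm` a Hermitian idempotent matrix which is BLOCK-DIAGONAL
(`Pm i l = 0` when `0 < d i l`) — the orthogonal projection onto a block-local subspace `N`; `Δm` Hermitian.  With
    `S := Pm Δm Δm Pm + κ(1 − Pm)`   and   `Rm := Δm Pm S⁻¹ Pm Δm`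
(§2): `⟨v, S v⟩ = ‖Δm Pm v‖² + κ‖(1 − Pm) v‖²`, so COERCIVITY OF `Δm` ON `N` (`c²‖Pm v‖² ≤ ‖Δm Pm v‖²`) makes `S` `min(c², κ)`-accretive; `S` commutes with `Pm`; hence (§3) `Rm` is
Hermitian, idempotent, fixes `Δm Pm`, and factors through `Δm Pm` — i.e. `Rm` IS the orthogonal projection onto `range(Δm Pm) = Δm(N)`, print's `R`.  (§4) If the OFF-BLOCK Schur budget
of `S` at rate `μ` is at most `m∕2` — the block-diagonal part of `S`, in particular the whole of `κ(1 − Pm)`, costs NOTHING (`e^{μ·0} − 1 = 0`) — lit's Combes–Thomas theorem gives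
`‖S⁻¹ i j‖ ≤ (4∕m)·e^{−μ d(i,j)}`, and two finite-range multiplications on each side (§1) transfer the decay to `Rm` and to every sandwich `X Rm Y`, `X (1 − Rm) Y` off the blocks:
THE ENTRIES OF PRINT'S PROJECTOR AND OF `P = 1 − R` DECAY EXPONENTIALLY IN BLOCK DISTANCE with constants depending only on `(m, μ, ranges, entry sizes, neighbour counts)` — never on
the volume.  (§5) The Schur budget from range∕size∕count data.  This is the Målqvist–Peterseim (LOD) localisation argument for the `H²`-type form `⟨Δν, Δμ⟩` on the fine-scale
space `N`, run through Combes–Thomas instead of iterated Caccioppoli.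

References: T. Bałaban, CMP **99** (1985) 389–434 [Balaban1985BackgroundPropagators] ((3.21) p.394, (3.49) p.399); CMP **116** (1988) 1–22 [Balaban1988RG2Cluster] ((2.7) p.13,
the Combes–Thomas bound of the lit engine); A. Målqvist, D. Peterseim, Math. Comp. **83** (2014) 2583–2603 (localisation of correctors).
-/

set_option autoImplicit false

noncomputable section

open scoped Matrix ComplexConjugate BigOperators
open Finset

namespace Summit.QuantumFields.YangMills.Theorems.Prop7ProjRangeKernelDecayCT

open Literature.MathematicalPhysics.QuantumFieldTheory.Balaban1983to89.B13Sqrt27AccretiveAlmostLocal (almostLocal_inverse_decay)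

variable {n : Type*} [Fintype n]

/-! ## §1 Finite range × exponential decay, sandwiches, Schur budgets (no inverse needed) -/

/-- **FINITE RANGE × DECAY**: if `X i k = 0` beyond `d`-range `r`, `‖X i k‖ ≤ x`, at most `N` indices lie within distance `r` of any index, and `‖Y k j‖ ≤ C e^{−μ d(k,j)}`, then
`‖(X Y) i j‖ ≤ N·x·C·e^{μ r}·e^{−μ d(i,j)}` (triangle inequality for `d`). [cite: Balaban1985BackgroundPropagators, p.415 («random walk expansions», one local step)] -/
theorem norm_mul_apply_le_of_range_of_decay (d : n → n → ℝ) (hdt : ∀ i j k, d i k ≤ d i j + d j k)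
    (X Y : Matrix n n ℂ) {r x C μ : ℝ} {N : ℕ} (hx : 0 ≤ x) (hC : 0 ≤ C) (hμ : 0 ≤ μ)
    (hXr : ∀ i k, r < d i k → X i k = 0) (hXx : ∀ i k, ‖X i k‖ ≤ x)
    (hN : ∀ i, (univ.filter fun k => d i k ≤ r).card ≤ N)
    (hY : ∀ k j, ‖Y k j‖ ≤ C * Real.exp (-(μ * d k j))) (i j : n) :
    ‖(X * Y) i j‖ ≤ N * x * C * Real.exp (μ * r) * Real.exp (-(μ * d i j)) := by
  rw [Matrix.mul_apply]
  have hsplit : ∑ k, X i k * Y k j = ∑ k ∈ univ.filter (fun k => d i k ≤ r), X i k * Y k j := by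
    rw [← Finset.sum_filter_add_sum_filter_not univ (fun k => d i k ≤ r)]
    rw [Finset.sum_eq_zero (s := univ.filter fun k => ¬ d i k ≤ r), add_zero]
    intro k hk
    rw [hXr i k (lt_of_not_ge (Finset.mem_filter.mp hk).2), zero_mul]
  rw [hsplit]
  refine (norm_sum_le _ _).trans ?_
  have hterm : ∀ k ∈ univ.filter (fun k => d i k ≤ r), ‖X i k * Y k j‖ ≤ x * C * Real.exp (μ * r) * Real.exp (-(μ * d i j)) := by
    intro k hk
    have hk' : d i k ≤ r := (Finset.mem_filter.mp hk).2
    rw [norm_mul]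
    have h1 : ‖Y k j‖ ≤ C * Real.exp (-(μ * d k j)) := hY k j
    have h2 : Real.exp (-(μ * d k j)) ≤ Real.exp (μ * r) * Real.exp (-(μ * d i j)) := by
      rw [← Real.exp_add]
      apply Real.exp_le_exp.mpr
      have := hdt i k j
      nlinarith [mul_le_mul_of_nonneg_left this hμ, mul_le_mul_of_nonneg_left hk' hμ]
    calc ‖X i k‖ * ‖Y k j‖ ≤ x * (C * Real.exp (-(μ * d k j))) := mul_le_mul (hXx i k) h1 (norm_nonneg _) hx
      _ ≤ x * (C * (Real.exp (μ * r) * Real.exp (-(μ * d i j)))) := by gcongr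
      _ = x * C * Real.exp (μ * r) * Real.exp (-(μ * d i j)) := by ring
  refine (Finset.sum_le_sum hterm).trans ?_
  rw [Finset.sum_const, nsmul_eq_mul]
  have hnn : 0 ≤ x * C * Real.exp (μ * r) * Real.exp (-(μ * d i j)) := by positivity
  calc ((univ.filter fun k => d i k ≤ r).card : ℝ) * (x * C * Real.exp (μ * r) * Real.exp (-(μ * d i j)))
      ≤ (N : ℝ) * (x * C * Real.exp (μ * r) * Real.exp (-(μ * d i j))) := by
        exact mul_le_mul_of_nonneg_right (by exact_mod_cast hN i) hnn
    _ = N * x * C * Real.exp (μ * r) * Real.exp (-(μ * d i j)) := by ring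

/-- **DECAY × FINITE RANGE** (the mirror image, column counts). [cite: Balaban1985BackgroundPropagators, p.415] -/
theorem norm_mul_apply_le_of_decay_of_range (d : n → n → ℝ) (hdt : ∀ i j k, d i k ≤ d i j + d j k)
    (Y X : Matrix n n ℂ) {r x C μ : ℝ} {N : ℕ} (hx : 0 ≤ x) (hC : 0 ≤ C) (hμ : 0 ≤ μ)
    (hXr : ∀ k j, r < d k j → X k j = 0) (hXx : ∀ k j, ‖X k j‖ ≤ x)
    (hN : ∀ j, (univ.filter fun k => d k j ≤ r).card ≤ N)
    (hY : ∀ i k, ‖Y i k‖ ≤ C * Real.exp (-(μ * d i k))) (i j : n) :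
    ‖(Y * X) i j‖ ≤ N * x * C * Real.exp (μ * r) * Real.exp (-(μ * d i j)) := by
  -- transpose everything and use the row version
  have h := norm_mul_apply_le_of_range_of_decay (fun a b => d b a) (fun a b c => by show d c a ≤ d b a + d c b; linarith [hdt c b a])
    Xᵀ Yᵀ (r := r) (x := x) (C := C) (μ := μ) (N := N) hx hC hμ
    (fun a b hab => by rw [Matrix.transpose_apply]; exact hXr b a hab) (fun a b => by rw [Matrix.transpose_apply]; exact hXx b a)
    (fun a => by simpa using hN a) (fun a b => by rw [Matrix.transpose_apply]; exact hY b a) j i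
  have hT : (Xᵀ * Yᵀ) j i = (Y * X) i j := by rw [← Matrix.transpose_mul]; rfl
  rw [hT] at h
  exact h

/-- ★★ **SANDWICHES** (`DPD*`-type kernels): finite-range `X` (range `rX`, entries `≤ x`, counts `NX`) on the left and `Y` (range `rY`, entries `≤ y`, counts `NY`) on the right of a
kernel with decay `(C, μ)` give decay `(NX·x·NY·y·C·e^{μ(rX+rY)}, μ)`. [cite: Balaban1985BackgroundPropagators, (3.49) p.399 (the four kernels `P, DP, PD*, DPD*`)] -/
theorem sandwich_decay (d : n → n → ℝ) (hds : ∀ i j, d i j = d j i) (hdt : ∀ i j k, d i k ≤ d i j + d j k)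
    (X M Y : Matrix n n ℂ) {rX rY x y C μ : ℝ} {NX NY : ℕ} (hx : 0 ≤ x) (hy : 0 ≤ y) (hC : 0 ≤ C) (hμ : 0 ≤ μ)
    (hXr : ∀ i k, rX < d i k → X i k = 0) (hXx : ∀ i k, ‖X i k‖ ≤ x) (hNX : ∀ i, (univ.filter fun k => d i k ≤ rX).card ≤ NX)
    (hYr : ∀ k j, rY < d k j → Y k j = 0) (hYy : ∀ k j, ‖Y k j‖ ≤ y) (hNY : ∀ j, (univ.filter fun k => d j k ≤ rY).card ≤ NY)
    (hM : ∀ k l, ‖M k l‖ ≤ C * Real.exp (-(μ * d k l))) (i j : n) :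
    ‖(X * M * Y) i j‖ ≤ NX * x * (NY * y * C * Real.exp (μ * rY)) * Real.exp (μ * rX) * Real.exp (-(μ * d i j)) := by
  have hNY' : ∀ j, (univ.filter fun k => d k j ≤ rY).card ≤ NY := fun j => by simpa [hds] using hNY j
  have h1 : ∀ a b, ‖(M * Y) a b‖ ≤ NY * y * C * Real.exp (μ * rY) * Real.exp (-(μ * d a b)) :=
    norm_mul_apply_le_of_decay_of_range d hdt M Y hy hC hμ hYr hYy hNY' hM
  have h2 := norm_mul_apply_le_of_range_of_decay d hdt X (M * Y) hx (by positivity) hμ hXr hXx hNX h1 i j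
  rw [Matrix.mul_assoc]
  exact h2


/-! ### The Schur budget from range ∕ size ∕ count data (how a member discharges `hrow`, `hcol`) -/

/-- ★ **OFF-BLOCK SCHUR BUDGET OF A FINITE-RANGE MATRIX**: if `A i l = 0` beyond `d`-range `ρ`, `‖A i l‖ ≤ s` whenever `0 < d i l`, and at most `N` indices lie within distance `ρ` of
any index, then `Σ_l ‖A i l‖(e^{μ d(i,l)} − 1) ≤ N·s·(e^{μρ} − 1)` — the in-block entries (`d = 0`) are free whatever their size. [cite: Balaban1988RG2Cluster, (2.7) p.13] -/
theorem schur_budget_of_range (d : n → n → ℝ) (hdnn : ∀ i j, 0 ≤ d i j) (A : Matrix n n ℂ) {ρ s μ : ℝ} {N : ℕ} (hs : 0 ≤ s) (hμ : 0 ≤ μ) (hρ : 0 ≤ ρ)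
    (hAρ : ∀ i l, ρ < d i l → A i l = 0) (hAs : ∀ i l, 0 < d i l → ‖A i l‖ ≤ s) (hN : ∀ i, (univ.filter fun l => d i l ≤ ρ).card ≤ N) (i : n) :
    ∑ l, ‖A i l‖ * (Real.exp (μ * d i l) - 1) ≤ N * s * (Real.exp (μ * ρ) - 1) := by
  have hterm : ∀ l, ‖A i l‖ * (Real.exp (μ * d i l) - 1) ≤ if d i l ≤ ρ then s * (Real.exp (μ * ρ) - 1) else 0 := by
    intro l
    split_ifs with h
    · by_cases h0 : 0 < d i l
      · refine mul_le_mul (hAs i l h0) ?_ ?_ hs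
        · exact sub_le_sub_right (Real.exp_le_exp.mpr (mul_le_mul_of_nonneg_left h hμ)) 1
        · rw [sub_nonneg]; exact Real.one_le_exp (mul_nonneg hμ (hdnn i l))
      · have : d i l = 0 := le_antisymm (le_of_not_gt h0) (hdnn i l)
        rw [this, mul_zero, Real.exp_zero, sub_self, mul_zero]
        exact mul_nonneg hs (by rw [sub_nonneg]; exact Real.one_le_exp (mul_nonneg hμ hρ))
    · rw [hAρ i l (lt_of_not_ge h), norm_zero, zero_mul]
  refine (Finset.sum_le_sum fun l _ => hterm l).trans ?_
  rw [Finset.sum_ite, Finset.sum_const_zero, add_zero, Finset.sum_const, nsmul_eq_mul]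
  have hnn : 0 ≤ s * (Real.exp (μ * ρ) - 1) := mul_nonneg hs (by rw [sub_nonneg]; exact Real.one_le_exp (mul_nonneg hμ hρ))
  calc ((univ.filter fun l => d i l ≤ ρ).card : ℝ) * (s * (Real.exp (μ * ρ) - 1)) ≤ N * (s * (Real.exp (μ * ρ) - 1)) :=
        mul_le_mul_of_nonneg_right (by exact_mod_cast hN i) hnn
    _ = N * s * (Real.exp (μ * ρ) - 1) := by ring

/-- The column budget (symmetric pseudo-metric). [cite: Balaban1988RG2Cluster, (2.7) p.13] -/
theorem schur_budget_of_range_col (d : n → n → ℝ) (hdnn : ∀ i j, 0 ≤ d i j) (A : Matrix n n ℂ) {ρ s μ : ℝ} {N : ℕ}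
    (hs : 0 ≤ s) (hμ : 0 ≤ μ) (hρ : 0 ≤ ρ) (hAρ : ∀ i l, ρ < d i l → A i l = 0) (hAs : ∀ i l, 0 < d i l → ‖A i l‖ ≤ s)
    (hN : ∀ l, (univ.filter fun i => d i l ≤ ρ).card ≤ N) (l : n) :
    ∑ i, ‖A i l‖ * (Real.exp (μ * d i l) - 1) ≤ N * s * (Real.exp (μ * ρ) - 1) := by
  have h := schur_budget_of_range (fun a b => d b a) (fun a b => hdnn b a) Aᵀ (ρ := ρ) (s := s) (μ := μ) (N := N) hs hμ hρ
    (fun a b hab => by rw [Matrix.transpose_apply]; exact hAρ b a hab) (fun a b hab => by rw [Matrix.transpose_apply]; exact hAs b a hab) hN l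
  simpa [Matrix.transpose_apply] using h


/-- `Re Σ_i w̄_i w_i = Σ_i |w_i|²`. [cite: Balaban1985BackgroundPropagators, (3.21) p.394] -/
theorem re_sum_star_mul_self (w : n → ℂ) : (∑ i, star (w i) * w i).re = ∑ i, ‖w i‖ ^ 2 := by
  have h : ∑ i, star (w i) * w i = ∑ i, (((‖w i‖ ^ 2 : ℝ)) : ℂ) :=
    Finset.sum_congr rfl fun i _ => by rw [Complex.star_def, Complex.conj_mul', Complex.ofReal_pow]
  rw [h, ← Complex.ofReal_sum, Complex.ofReal_re]

/-- `Σ_i v̄_i ((BᴴB)v)_i = Σ_i |(Bv)_i|²` (as a real part). [cite: Balaban1985BackgroundPropagators, (3.21) p.394] -/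
theorem re_star_mulVec_conjTranspose_mul (B : Matrix n n ℂ) (v : n → ℂ) :
    (∑ i, star (v i) * ((Bᴴ * B) *ᵥ v) i).re = ∑ i, ‖(B *ᵥ v) i‖ ^ 2 := by
  have h1 : ∑ i, star (v i) * ((Bᴴ * B) *ᵥ v) i = star v ⬝ᵥ ((Bᴴ * B) *ᵥ v) := rfl
  rw [h1, ← Matrix.mulVec_mulVec, Matrix.dotProduct_mulVec, ← Matrix.star_mulVec]
  exact re_sum_star_mul_self (B *ᵥ v)

section WithOne

variable [DecidableEq n]

/-! ## §2 The operator `S = Pm Δm² Pm + κ(1 − Pm)`: quadratic form and accretivity -/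

omit [DecidableEq n] in
/-- For a Hermitian idempotent `Pm` (an orthogonal projection): `Σ v̄_i (Pm v)_i = Σ |(Pm v)_i|²`. [cite: Balaban1985BackgroundPropagators, (3.21) p.394] -/
theorem re_star_mulVec_proj {Pm : Matrix n n ℂ} (hPh : Pm.IsHermitian) (hP2 : Pm * Pm = Pm) (v : n → ℂ) :
    (∑ i, star (v i) * (Pm *ᵥ v) i).re = ∑ i, ‖(Pm *ᵥ v) i‖ ^ 2 := by
  have h : Pmᴴ * Pm = Pm := by rw [hPh.eq, hP2]
  rw [← re_star_mulVec_conjTranspose_mul Pm v, h]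

/-- Pythagoras for an orthogonal projection: `Σ|v_i|² = Σ|(Pm v)_i|² + Σ|((1−Pm)v)_i|²`. [cite: Balaban1985BackgroundPropagators, (3.21) p.394] -/
theorem sum_norm_sq_eq_proj_add {Pm : Matrix n n ℂ} (hPh : Pm.IsHermitian) (hP2 : Pm * Pm = Pm) (v : n → ℂ) :
    ∑ i, ‖v i‖ ^ 2 = ∑ i, ‖(Pm *ᵥ v) i‖ ^ 2 + ∑ i, ‖((1 - Pm) *ᵥ v) i‖ ^ 2 := by
  have hQh : (1 - Pm).IsHermitian := Matrix.isHermitian_one.sub hPh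
  have hQ2 : (1 - Pm) * (1 - Pm) = 1 - Pm := by rw [sub_mul, mul_sub, mul_sub, one_mul, one_mul, mul_one, hP2, sub_self, sub_zero]
  rw [← re_star_mulVec_proj hPh hP2 v, ← re_star_mulVec_proj hQh hQ2 v, ← Complex.add_re, ← Finset.sum_add_distrib]
  have h : ∀ i, star (v i) * (Pm *ᵥ v) i + star (v i) * ((1 - Pm) *ᵥ v) i = star (v i) * v i := by
    intro i
    rw [← mul_add, Matrix.sub_mulVec, Matrix.one_mulVec, Pi.sub_apply, add_sub_cancel]
  simp_rw [h]
  exact (re_sum_star_mul_self v).symm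

/-- **THE QUADRATIC FORM OF `S`**: `Re Σ v̄_i (S v)_i = Σ|(Δm Pm v)_i|² + κ Σ|((1−Pm)v)_i|²` for `S = Pm Δm Δm Pm + κ(1 − Pm)`, `Δm`, `Pm` Hermitian, `Pm² = Pm`.
[cite: Balaban1985BackgroundPropagators, (3.21)–(3.23) p.394] -/
theorem re_form_S {Δm Pm S : Matrix n n ℂ} (hΔh : Δm.IsHermitian) (hPh : Pm.IsHermitian) (hP2 : Pm * Pm = Pm) {κ : ℝ}
    (hS : S = Pm * Δm * Δm * Pm + (κ : ℂ) • (1 - Pm)) (v : n → ℂ) :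
    (∑ i, star (v i) * (S *ᵥ v) i).re = ∑ i, ‖((Δm * Pm) *ᵥ v) i‖ ^ 2 + κ * ∑ i, ‖((1 - Pm) *ᵥ v) i‖ ^ 2 := by
  have hB : (Δm * Pm)ᴴ * (Δm * Pm) = Pm * Δm * Δm * Pm := by
    rw [Matrix.conjTranspose_mul, hΔh.eq, hPh.eq, Matrix.mul_assoc, Matrix.mul_assoc, Matrix.mul_assoc]
  have hQh : (1 - Pm).IsHermitian := Matrix.isHermitian_one.sub hPh
  rw [hS, Matrix.add_mulVec, Matrix.smul_mulVec]
  simp_rw [Pi.add_apply, Pi.smul_apply, smul_eq_mul, mul_add, Finset.sum_add_distrib, Complex.add_re]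
  congr 1
  · rw [← hB]; exact re_star_mulVec_conjTranspose_mul _ v
  · have h : ∑ i, star (v i) * ((κ : ℂ) * ((1 - Pm) *ᵥ v) i) = (κ : ℂ) * ∑ i, star (v i) * ((1 - Pm) *ᵥ v) i := by
      rw [Finset.mul_sum]; exact Finset.sum_congr rfl fun i _ => by ring
    rw [h, Complex.re_ofReal_mul, re_star_mulVec_proj hQh (by rw [sub_mul, mul_sub, mul_sub, one_mul, one_mul, mul_one, hP2, sub_self, sub_zero] : (1 - Pm) * (1 - Pm) = 1 - Pm)]

/-- ★★ **ACCRETIVITY OF `S` FROM COERCIVITY OF `Δm` ON `N = range Pm`**: if `c²·Σ|(Pm v)_i|² ≤ Σ|(Δm Pm v)_i|²` for every `v` and `0 < κ`, then `S` is `min(c², κ)`-accretive.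
(Here is where the member supplies the BLOCK covariant Poincaré inequality on `ker Q″`.) [cite: Balaban1985BackgroundPropagators, (3.21)–(3.23) p.394] -/
theorem accretive_S {Δm Pm S : Matrix n n ℂ} (hΔh : Δm.IsHermitian) (hPh : Pm.IsHermitian) (hP2 : Pm * Pm = Pm) {κ c : ℝ}
    (hS : S = Pm * Δm * Δm * Pm + (κ : ℂ) • (1 - Pm))
    (hcoer : ∀ v : n → ℂ, c ^ 2 * ∑ i, ‖(Pm *ᵥ v) i‖ ^ 2 ≤ ∑ i, ‖((Δm * Pm) *ᵥ v) i‖ ^ 2) (v : n → ℂ) :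
    min (c ^ 2) κ * ∑ i, ‖v i‖ ^ 2 ≤ (∑ i, star (v i) * (S *ᵥ v) i).re := by
  rw [re_form_S hΔh hPh hP2 hS v, sum_norm_sq_eq_proj_add hPh hP2 v, mul_add]
  have h1 : min (c ^ 2) κ * ∑ i, ‖(Pm *ᵥ v) i‖ ^ 2 ≤ ∑ i, ‖((Δm * Pm) *ᵥ v) i‖ ^ 2 :=
    (mul_le_mul_of_nonneg_right (min_le_left _ _) (Finset.sum_nonneg fun i _ => by positivity)).trans (hcoer v)
  have h2 : min (c ^ 2) κ * ∑ i, ‖((1 - Pm) *ᵥ v) i‖ ^ 2 ≤ κ * ∑ i, ‖((1 - Pm) *ᵥ v) i‖ ^ 2 :=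
    mul_le_mul_of_nonneg_right (min_le_right _ _) (Finset.sum_nonneg fun i _ => by positivity)
  linarith

/-- `S` is Hermitian. [cite: Balaban1985BackgroundPropagators, (3.21) p.394] -/
theorem isHermitian_S {Δm Pm S : Matrix n n ℂ} (hΔh : Δm.IsHermitian) (hPh : Pm.IsHermitian) {κ : ℝ}
    (hS : S = Pm * Δm * Δm * Pm + (κ : ℂ) • (1 - Pm)) : S.IsHermitian := by
  rw [hS]
  refine Matrix.IsHermitian.add ?_ ?_
  · show (Pm * Δm * Δm * Pm)ᴴ = Pm * Δm * Δm * Pm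
    rw [Matrix.conjTranspose_mul, Matrix.conjTranspose_mul, Matrix.conjTranspose_mul, hΔh.eq, hPh.eq, ← Matrix.mul_assoc, ← Matrix.mul_assoc]
  · show ((κ : ℂ) • (1 - Pm))ᴴ = (κ : ℂ) • (1 - Pm)
    rw [Matrix.conjTranspose_smul, (Matrix.isHermitian_one.sub hPh).eq, Complex.star_def, Complex.conj_ofReal]

/-- `S` commutes with `Pm` (both products equal `Pm Δm Δm Pm`). [cite: Balaban1985BackgroundPropagators, (3.21) p.394] -/
theorem proj_mul_S {Δm Pm S : Matrix n n ℂ} (hP2 : Pm * Pm = Pm) {κ : ℝ} (hS : S = Pm * Δm * Δm * Pm + (κ : ℂ) • (1 - Pm)) :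
    Pm * S = Pm * Δm * Δm * Pm ∧ S * Pm = Pm * Δm * Δm * Pm := by
  have h1 : Pm * (1 - Pm) = 0 := by rw [mul_sub, mul_one, hP2, sub_self]
  have h2 : (1 - Pm) * Pm = 0 := by rw [sub_mul, one_mul, hP2, sub_self]
  refine ⟨?_, ?_⟩
  · rw [hS, mul_add, Matrix.mul_smul, h1, smul_zero, add_zero, ← Matrix.mul_assoc, ← Matrix.mul_assoc, ← Matrix.mul_assoc, hP2]
  · rw [hS, add_mul, Matrix.smul_mul, h2, smul_zero, add_zero, Matrix.mul_assoc, hP2]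

/-! ## §3 `Rm = Δm Pm S⁻¹ Pm Δm` is the orthogonal projection onto `range(Δm Pm)` -/

section Projector

variable {Δm Pm S R : Matrix n n ℂ} {κ : ℝ}

/-- `S⁻¹` commutes with `Pm` when `S` is invertible. [cite: Balaban1985BackgroundPropagators, (3.21) p.394] -/
theorem inv_S_mul_proj (hP2 : Pm * Pm = Pm) (hS : S = Pm * Δm * Δm * Pm + (κ : ℂ) • (1 - Pm)) (hunit : IsUnit S.det) :
    S⁻¹ * Pm = Pm * S⁻¹ := by
  obtain ⟨h1, h2⟩ := proj_mul_S (Δm := Δm) hP2 hS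
  have hc : Pm * S = S * Pm := by rw [h1, h2]
  calc S⁻¹ * Pm = S⁻¹ * Pm * (S * S⁻¹) := by rw [Matrix.mul_nonsing_inv _ hunit, Matrix.mul_one]
    _ = S⁻¹ * (Pm * S) * S⁻¹ := by simp only [Matrix.mul_assoc]
    _ = S⁻¹ * (S * Pm) * S⁻¹ := by rw [hc]
    _ = (S⁻¹ * S) * Pm * S⁻¹ := by simp only [Matrix.mul_assoc]
    _ = Pm * S⁻¹ := by rw [Matrix.nonsing_inv_mul _ hunit, Matrix.one_mul]

/-- ★ **`Rm` FIXES `range(Δm Pm)`**: `Rm (Δm Pm) = Δm Pm`. [cite: Balaban1985BackgroundPropagators, (3.21) p.394] -/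
theorem R_mul_range (hP2 : Pm * Pm = Pm) (hS : S = Pm * Δm * Δm * Pm + (κ : ℂ) • (1 - Pm)) (hunit : IsUnit S.det)
    (hR : R = Δm * Pm * S⁻¹ * Pm * Δm) : R * (Δm * Pm) = Δm * Pm := by
  obtain ⟨h1, h2⟩ := proj_mul_S (Δm := Δm) hP2 hS
  have hcomm := inv_S_mul_proj (Δm := Δm) hP2 hS hunit
  -- `Pm Δm Δm Pm = S Pm`
  calc R * (Δm * Pm) = Δm * Pm * S⁻¹ * (Pm * Δm * Δm * Pm) := by rw [hR]; simp only [Matrix.mul_assoc]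
    _ = Δm * Pm * S⁻¹ * (S * Pm) := by rw [h2]
    _ = Δm * Pm * (S⁻¹ * S) * Pm := by simp only [Matrix.mul_assoc]
    _ = Δm * Pm := by rw [Matrix.nonsing_inv_mul _ hunit, Matrix.mul_one, Matrix.mul_assoc, hP2]

/-- ★ **`Rm` IS IDEMPOTENT**. [cite: Balaban1985BackgroundPropagators, (3.21) p.394] -/
theorem R_mul_R (hP2 : Pm * Pm = Pm) (hS : S = Pm * Δm * Δm * Pm + (κ : ℂ) • (1 - Pm)) (hunit : IsUnit S.det)
    (hR : R = Δm * Pm * S⁻¹ * Pm * Δm) : R * R = R := by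
  have hfix := R_mul_range hP2 hS hunit hR
  calc R * R = R * (Δm * Pm) * (S⁻¹ * Pm * Δm) := by rw [hR]; simp only [Matrix.mul_assoc]
    _ = Δm * Pm * (S⁻¹ * Pm * Δm) := by rw [hfix]
    _ = R := by rw [hR]; simp only [Matrix.mul_assoc]

/-- ★ **`Rm` IS HERMITIAN** (`Δm`, `Pm` Hermitian, `κ` real). [cite: Balaban1985BackgroundPropagators, (3.21) p.394] -/
theorem isHermitian_R (hΔh : Δm.IsHermitian) (hPh : Pm.IsHermitian) (hS : S = Pm * Δm * Δm * Pm + (κ : ℂ) • (1 - Pm))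
    (hR : R = Δm * Pm * S⁻¹ * Pm * Δm) : R.IsHermitian := by
  have hSh := isHermitian_S hΔh hPh hS
  have hSih : S⁻¹.IsHermitian := hSh.inv
  show Rᴴ = R
  rw [hR, Matrix.conjTranspose_mul, Matrix.conjTranspose_mul, Matrix.conjTranspose_mul, Matrix.conjTranspose_mul, hΔh.eq, hPh.eq, hSih.eq]
  simp only [Matrix.mul_assoc]

/-- ★ **`Rm` FACTORS THROUGH `Δm Pm`** (its range lies in `range(Δm Pm) = Δm(N)`). Together with `R_mul_range`, `R_mul_R`, `isHermitian_R`: `Rm` is THE orthogonal projection onto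
`Δm(N)` — print's `R`. [cite: Balaban1985BackgroundPropagators, (3.21) p.394] -/
theorem R_eq_range_mul (hR : R = Δm * Pm * S⁻¹ * Pm * Δm) : ∃ W : Matrix n n ℂ, R = Δm * Pm * W :=
  ⟨S⁻¹ * Pm * Δm, by rw [hR]; simp only [Matrix.mul_assoc]⟩

/-- The range vectors: `Rm (Δm (Pm w)) = Δm (Pm w)` on vectors. [cite: Balaban1985BackgroundPropagators, (3.21) p.394] -/
theorem R_mulVec_range (hP2 : Pm * Pm = Pm) (hS : S = Pm * Δm * Δm * Pm + (κ : ℂ) • (1 - Pm)) (hunit : IsUnit S.det)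
    (hR : R = Δm * Pm * S⁻¹ * Pm * Δm) (w : n → ℂ) : R *ᵥ ((Δm * Pm) *ᵥ w) = (Δm * Pm) *ᵥ w := by
  rw [Matrix.mulVec_mulVec, R_mul_range hP2 hS hunit hR]

end Projector

/-! ## §4 Exponential decay of `S⁻¹`, of `Rm`, and of the sandwiches -/

section Decay

variable (d : n → n → ℝ)

/-- ★★★ **COMBES–THOMAS FOR `S`** (lit ✓`almostLocal_inverse_decay` at the accretivity of `accretive_S`): with the OFF-BLOCK Schur budget of `S` at rate `μ` at most `m∕2`,
`m = min(c², κ)`, the inverse exists and `‖S⁻¹ i j‖ ≤ (4∕m)·e^{−μ d(i,j)}`.  Block-diagonal entries of `S` (all of `κ(1−Pm)`, the in-block part of `PmΔm²Pm`) do not enter the budget.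
[cite: Balaban1985BackgroundPropagators, (3.49) p.399; Balaban1988RG2Cluster, (2.7) p.13] -/
theorem inv_S_decay (hd0 : ∀ i, d i i = 0) (hds : ∀ i j, d i j = d j i) (hdt : ∀ i j k, d i k ≤ d i j + d j k)
    {Δm Pm S : Matrix n n ℂ} (hΔh : Δm.IsHermitian) (hPh : Pm.IsHermitian) (hP2 : Pm * Pm = Pm) {κ c μ ϱ : ℝ} (hκ : 0 < κ) (hc : 0 < c)
    (hS : S = Pm * Δm * Δm * Pm + (κ : ℂ) • (1 - Pm))
    (hcoer : ∀ v : n → ℂ, c ^ 2 * ∑ i, ‖(Pm *ᵥ v) i‖ ^ 2 ≤ ∑ i, ‖((Δm * Pm) *ᵥ v) i‖ ^ 2)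
    (hμ : 0 ≤ μ) (hϱ : 0 ≤ ϱ) (hϱm : ϱ ≤ min (c ^ 2) κ / 2)
    (hrow : ∀ i, ∑ l, ‖S i l‖ * (Real.exp (μ * d i l) - 1) ≤ ϱ) (hcol : ∀ l, ∑ i, ‖S i l‖ * (Real.exp (μ * d i l) - 1) ≤ ϱ) :
    IsUnit S.det ∧ ∀ i j, ‖S⁻¹ i j‖ ≤ 4 / min (c ^ 2) κ * Real.exp (-(μ * d i j)) :=
  almostLocal_inverse_decay d hd0 hds hdt S (lt_min (by positivity) hκ) hμ hϱ hϱm (accretive_S hΔh hPh hP2 hS hcoer) hrow hcol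

/-- ★★★ **DECAY OF PRINT'S PROJECTOR**: under the hypotheses of `inv_S_decay`, if `Δm` has `d`-range `r` with entries `≤ t`, `Pm` is block-diagonal (`d`-range `0`) with entries `≤ p`,
and at most `N₀` (resp. `N_r`) indices lie within distance `0` (resp. `r`) of any index, then
`‖Rm i j‖ ≤ (N_r t)² (N₀ p)² e^{2μr} (4∕m) e^{−μ d(i,j)}` for `Rm = Δm Pm S⁻¹ Pm Δm`. [cite: Balaban1985BackgroundPropagators, (3.49) p.399] -/
theorem R_decay (hd0 : ∀ i, d i i = 0) (hds : ∀ i j, d i j = d j i) (hdt : ∀ i j k, d i k ≤ d i j + d j k)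
    {Δm Pm S R : Matrix n n ℂ} (hΔh : Δm.IsHermitian) (hPh : Pm.IsHermitian) (hP2 : Pm * Pm = Pm) {κ c μ ϱ t p r : ℝ} {N₀ Nr : ℕ}
    (hκ : 0 < κ) (hc : 0 < c) (hS : S = Pm * Δm * Δm * Pm + (κ : ℂ) • (1 - Pm)) (hR : R = Δm * Pm * S⁻¹ * Pm * Δm)
    (hcoer : ∀ v : n → ℂ, c ^ 2 * ∑ i, ‖(Pm *ᵥ v) i‖ ^ 2 ≤ ∑ i, ‖((Δm * Pm) *ᵥ v) i‖ ^ 2)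
    (hμ : 0 ≤ μ) (hϱ : 0 ≤ ϱ) (hϱm : ϱ ≤ min (c ^ 2) κ / 2)
    (hrow : ∀ i, ∑ l, ‖S i l‖ * (Real.exp (μ * d i l) - 1) ≤ ϱ) (hcol : ∀ l, ∑ i, ‖S i l‖ * (Real.exp (μ * d i l) - 1) ≤ ϱ)
    (ht : 0 ≤ t) (hp : 0 ≤ p)
    (hΔr : ∀ i k, r < d i k → Δm i k = 0) (hΔt : ∀ i k, ‖Δm i k‖ ≤ t) (hPr : ∀ i k, 0 < d i k → Pm i k = 0) (hPp : ∀ i k, ‖Pm i k‖ ≤ p)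
    (hN₀ : ∀ i, (univ.filter fun k => d i k ≤ 0).card ≤ N₀) (hNr : ∀ i, (univ.filter fun k => d i k ≤ r).card ≤ Nr) (i j : n) :
    ‖R i j‖ ≤ (Nr * t * (N₀ * p * (N₀ * p * (Nr * t * (4 / min (c ^ 2) κ) * Real.exp (μ * r)) * Real.exp (μ * 0)) * Real.exp (μ * 0))) * Real.exp (μ * r)
      * Real.exp (-(μ * d i j)) := by
  obtain ⟨hunit, hdec⟩ := inv_S_decay d hd0 hds hdt hΔh hPh hP2 hκ hc hS hcoer hμ hϱ hϱm hrow hcol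
  have hm : 0 < min (c ^ 2) κ := lt_min (by positivity) hκ
  have hNr' : ∀ j, (univ.filter fun k => d k j ≤ r).card ≤ Nr := fun j => by simpa [hds] using hNr j
  have hN₀' : ∀ j, (univ.filter fun k => d k j ≤ 0).card ≤ N₀ := fun j => by simpa [hds] using hN₀ j
  -- innermost: `S⁻¹ (Pm Δm)`: first `S⁻¹ Pm`... we peel from the right: `X₁ := S⁻¹ * Pm`? No — associate as `Δm * (Pm * ((S⁻¹ * Pm) * Δm))`.
  have h1 : ∀ a b, ‖(S⁻¹ * Pm) a b‖ ≤ N₀ * p * (4 / min (c ^ 2) κ) * Real.exp (μ * 0) * Real.exp (-(μ * d a b)) :=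
    norm_mul_apply_le_of_decay_of_range d hdt S⁻¹ Pm hp (by positivity) hμ (fun k j hk => hPr k j hk) hPp hN₀' hdec
  have h2 : ∀ a b, ‖(S⁻¹ * Pm * Δm) a b‖ ≤ Nr * t * (N₀ * p * (4 / min (c ^ 2) κ) * Real.exp (μ * 0)) * Real.exp (μ * r) * Real.exp (-(μ * d a b)) :=
    norm_mul_apply_le_of_decay_of_range d hdt (S⁻¹ * Pm) Δm ht (by positivity) hμ (fun k j hk => hΔr k j hk) hΔt hNr' h1
  have h3 : ∀ a b, ‖(Pm * (S⁻¹ * Pm * Δm)) a b‖ ≤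
      N₀ * p * (Nr * t * (N₀ * p * (4 / min (c ^ 2) κ) * Real.exp (μ * 0)) * Real.exp (μ * r)) * Real.exp (μ * 0) * Real.exp (-(μ * d a b)) :=
    norm_mul_apply_le_of_range_of_decay d hdt Pm (S⁻¹ * Pm * Δm) hp (by positivity) hμ (fun i k hk => hPr i k hk) hPp hN₀ h2
  have h4 : ∀ a b, ‖(Δm * (Pm * (S⁻¹ * Pm * Δm))) a b‖ ≤
      Nr * t * (N₀ * p * (Nr * t * (N₀ * p * (4 / min (c ^ 2) κ) * Real.exp (μ * 0)) * Real.exp (μ * r)) * Real.exp (μ * 0)) * Real.exp (μ * r) *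
        Real.exp (-(μ * d a b)) :=
    norm_mul_apply_le_of_range_of_decay d hdt Δm (Pm * (S⁻¹ * Pm * Δm)) ht (by positivity) hμ (fun i k hk => hΔr i k hk) hΔt hNr h3
  have hRe : R = Δm * (Pm * (S⁻¹ * Pm * Δm)) := by rw [hR]; simp only [Matrix.mul_assoc]
  rw [hRe]
  refine (h4 i j).trans (le_of_eq ?_)
  ring

/-- ★★ **THE CLEAN FORM**: `‖Rm i j‖ ≤ C_R·e^{−μ d(i,j)}` with `C_R := (4∕m)·(N_r t)²·(N₀ p)²·e^{2μr}`, `m = min(c², κ)`. [cite: Balaban1985BackgroundPropagators, (3.49) p.399] -/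
theorem R_decay' (hd0 : ∀ i, d i i = 0) (hds : ∀ i j, d i j = d j i) (hdt : ∀ i j k, d i k ≤ d i j + d j k)
    {Δm Pm S R : Matrix n n ℂ} (hΔh : Δm.IsHermitian) (hPh : Pm.IsHermitian) (hP2 : Pm * Pm = Pm) {κ c μ ϱ t p r : ℝ} {N₀ Nr : ℕ}
    (hκ : 0 < κ) (hc : 0 < c) (hS : S = Pm * Δm * Δm * Pm + (κ : ℂ) • (1 - Pm)) (hR : R = Δm * Pm * S⁻¹ * Pm * Δm)
    (hcoer : ∀ v : n → ℂ, c ^ 2 * ∑ i, ‖(Pm *ᵥ v) i‖ ^ 2 ≤ ∑ i, ‖((Δm * Pm) *ᵥ v) i‖ ^ 2)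
    (hμ : 0 ≤ μ) (hϱ : 0 ≤ ϱ) (hϱm : ϱ ≤ min (c ^ 2) κ / 2)
    (hrow : ∀ i, ∑ l, ‖S i l‖ * (Real.exp (μ * d i l) - 1) ≤ ϱ) (hcol : ∀ l, ∑ i, ‖S i l‖ * (Real.exp (μ * d i l) - 1) ≤ ϱ)
    (ht : 0 ≤ t) (hp : 0 ≤ p)
    (hΔr : ∀ i k, r < d i k → Δm i k = 0) (hΔt : ∀ i k, ‖Δm i k‖ ≤ t) (hPr : ∀ i k, 0 < d i k → Pm i k = 0) (hPp : ∀ i k, ‖Pm i k‖ ≤ p)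
    (hN₀ : ∀ i, (univ.filter fun k => d i k ≤ 0).card ≤ N₀) (hNr : ∀ i, (univ.filter fun k => d i k ≤ r).card ≤ Nr) (i j : n) :
    ‖R i j‖ ≤ 4 / min (c ^ 2) κ * (Nr * t) ^ 2 * (N₀ * p) ^ 2 * Real.exp (2 * μ * r) * Real.exp (-(μ * d i j)) := by
  have h := R_decay d hd0 hds hdt hΔh hPh hP2 hκ hc hS hR hcoer hμ hϱ hϱm hrow hcol ht hp hΔr hΔt hPr hPp hN₀ hNr i j
  rw [mul_zero, Real.exp_zero] at h
  have h2 : Real.exp (2 * μ * r) = Real.exp (μ * r) * Real.exp (μ * r) := by rw [← Real.exp_add]; ring_nf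
  rw [h2]
  refine h.trans (le_of_eq ?_)
  ring

omit [Fintype n] in
/-- ★★ **OFF THE BLOCKS, `P = 1 − R` HAS THE SAME DECAY**: for `0 < d i j` the identity matrix does not contribute. [cite: Balaban1985BackgroundPropagators, (3.49) p.399] -/
theorem one_sub_R_decay_off (hd0 : ∀ i, d i i = 0) {R : Matrix n n ℂ} {C μ : ℝ} (hRdec : ∀ i j, ‖R i j‖ ≤ C * Real.exp (-(μ * d i j)))
    (i j : n) (hij : 0 < d i j) : ‖(1 - R) i j‖ ≤ C * Real.exp (-(μ * d i j)) := by
  have hne : i ≠ j := fun h => by rw [h, hd0] at hij; exact lt_irrefl _ hij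
  rw [Matrix.sub_apply, Matrix.one_apply_ne hne, zero_sub, norm_neg]
  exact hRdec i j

omit [Fintype n] in
/-- ★ **EVERYWHERE, `P = 1 − R`**: `‖(1 − R) i j‖ ≤ (e^{μ d(i,j)} + C)·e^{−μ d(i,j)}` (the identity contributes only on the diagonal; for a block pseudo-metric read it with
`one_sub_R_decay_off` off the blocks). [cite: Balaban1985BackgroundPropagators, (3.49) p.399] -/
theorem one_sub_R_decay {R : Matrix n n ℂ} {C μ : ℝ} (hRdec : ∀ i j, ‖R i j‖ ≤ C * Real.exp (-(μ * d i j))) (i j : n) :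
    ‖(1 - R) i j‖ ≤ (Real.exp (μ * d i j) + C) * Real.exp (-(μ * d i j)) := by
  rw [Matrix.sub_apply]
  refine (norm_sub_le _ _).trans ?_
  rw [add_mul, ← Real.exp_add, add_neg_cancel, Real.exp_zero]
  have h1 : ‖(1 : Matrix n n ℂ) i j‖ ≤ 1 := by
    rw [Matrix.one_apply]; split_ifs <;> simp
  linarith [hRdec i j]

end Decay

end WithOne

end Summit.QuantumFields.YangMills.Theorems.Prop7ProjRangeKernelDecayCT

end
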